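import Literature.Computability.AlgebraicComplexity.GKKP11Thm3Proofs
import HarnessLib

/-!
# GKKP 2011, Theorem 1 ([LR06]): a formula of green size `e` with an addition is a determinant of
size `e + 1` — proof of the named fact `GKKP2011_thm1`

Topic `Literature/Computability/AlgebraicComplexity`; third proofs file for
`GKKP11SymmetricRepresentations.lean` (B. Grenet, E. L. Kaltofen, P. Koiran, N. Portier,
arXiv:1007.3804, held text `paper:arxiv-1007.3804`), **Theorem 1** (§2.1, p0007; Liu–Regan 2006):
"For every formula `φ` of green size `e` with at least one addition there is a square matrix `A` of
dimensions `e+1` whose entries are inputs of the formula and elements of `{0,1,-1,1/2}` such that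
`φ = det(A)`", typed (entry-set erratum recorded in the statement file) with entries inputs of `φ`
or constants of `k`; NOT symmetric (the digraph construction, Lemma 2).

Proof, in the matrix language of `GKKP11Thm2Proofs.lean` / `GKKP11Thm3Proofs.lean` (imported) rather than by
the printed cycle-cover count: `GKKP2011.Thm1.exists_signedABP` is the signed branching program with
constants (`|V| ≤ gsize(φ)`, link signs `d = ±1`, arcs `N`, source/sink arcs `a`, `b`, direct edge
`m`, constant `c₀` with `c₀ · (m − a·y) = φ`, `(D + N) y = b`, `det (D + N) = ±1`), together with
GKKP's observation (proof of Thm. 1, p0008) that when `φ` has an addition there is a vertex all of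
whose outgoing weights are constants — here the new vertex of a sum gadget. The digraph matrix is the
block matrix `M = [[m, a], [b, D + N]]` of size `|V| + 1` ("we merge `s` and `t`"): by the Schur
complement `det M = det (D + N) · (m − a·(D + N)⁻¹·b) = ± (m − a·y)`, and multiplying the constant
row of that vertex by `c₀ · det (D + N)` ("we change its weight to `c₀ c` and add a loop weighted by
`c₀`") gives determinant exactly `φ` with entries still inputs or constants; padding with isolated
vertices makes the size exactly `gsize(φ) + 1`.

No new definitions, no new facts. Honest framing: typed literature (an upper bound `dc ≤ gsize + 1`
for formulas); nothing here bears on `VP ≠ VNP`.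

## References

* [GrenetEtAl2011] B. Grenet, E. L. Kaltofen, P. Koiran, N. Portier, Contemp. Math. 556 (2011)
  61–96, arXiv:1007.3804: §2.1 Def. 6, Thm. 1, Lemma 2 and the proof of Thm. 1 (p0007–p0008).
* [LiuRegan2006] H. Liu, K. W. Regan, *Improved construction for universality of determinant and
  permanent*, Inform. Process. Lett. 100 (2006) 233–237 (the source's [LR06]).
-/

noncomputable section

open Matrix MvPolynomial Finset

namespace Literature.Computability.AlgebraicComplexity

namespace GKKP2011

namespace Thm1

variable {k : Type} [Field k] {σ : Type}

/-- **The signed branching program with constants, plus the vertex of GKKP's Lemma 2 / proof of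
Thm. 1** ("there is a vertex `v` that has only one outgoing edge and its weight is a constant `c` (as
`φ` is supposed to have at least one addition)", p0008): as in the proof of Thm. 3
(`|V| ≤ gsize(φ)`, entries inputs of `φ` or constants, unimodular transfer matrix `D + N`, constant
`c₀` with `c₀ · (m − a·y) = φ` where `(D + N) y = b`), and moreover, when `φ` has an addition gate,
an internal vertex `w` all of whose outgoing weights (`b w` and the row `N w ·`) are constants — the
new vertex of a sum gadget (sums with `c₁ = 0` use the mirrored gadget on `t₁` with sink weight
`0`). [cite: GrenetEtAl2011, Thm 1 (proof)] -/
theorem exists_signedABP (φ : ArithExpr k σ) :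
    ∃ (V : Type) (_ : Fintype V) (_ : DecidableEq V) (d : V → MvPolynomial σ k)
      (N : Matrix V V (MvPolynomial σ k)) (a b : V → MvPolynomial σ k) (m : MvPolynomial σ k)
      (c₀ : k),
      Fintype.card V ≤ φ.greenSize ∧
      (∀ v, d v = 1 ∨ d v = -1) ∧ (∀ v, N v v = 0) ∧
      (∀ u v, φ.IsInput (N u v) ∨ ∃ c : k, N u v = C c) ∧
      (∀ v, φ.IsInput (a v) ∨ ∃ c : k, a v = C c) ∧
      (∀ v, φ.IsInput (b v) ∨ ∃ c : k, b v = C c) ∧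
      (φ.IsInput m ∨ ∃ c : k, m = C c) ∧
      ((diagonal d + N).det = 1 ∨ (diagonal d + N).det = -1) ∧
      (φ.HasAddition → ∃ w, (∃ c : k, b w = C c) ∧ ∀ u, ∃ c : k, N w u = C c) ∧
      ∃ y : V → MvPolynomial σ k, (diagonal d + N) *ᵥ y = b ∧ C c₀ * (m - a ⬝ᵥ y) = φ.eval := by
  induction φ with
  | var i =>
    refine ⟨PEmpty, inferInstance, inferInstance, PEmpty.elim, Matrix.of fun v => v.elim,
      PEmpty.elim, PEmpty.elim, X i, 1, by simp, fun v => v.elim, fun v => v.elim,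
      fun v => v.elim, fun v => v.elim, fun v => v.elim, Or.inl rfl, Or.inl det_isEmpty,
      fun h => by simp [ArithExpr.HasAddition] at h, ?_⟩
    exact ⟨PEmpty.elim, funext fun v => v.elim, by simp [dotProduct, ArithExpr.eval]⟩
  | const c =>
    refine ⟨PEmpty, inferInstance, inferInstance, PEmpty.elim, Matrix.of fun v => v.elim,
      PEmpty.elim, PEmpty.elim, C c, 1, by simp, fun v => v.elim, fun v => v.elim,
      fun v => v.elim, fun v => v.elim, fun v => v.elim, Or.inr ⟨c, rfl⟩, Or.inl det_isEmpty,
      fun h => by simp [ArithExpr.HasAddition] at h, ?_⟩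
    exact ⟨PEmpty.elim, funext fun v => v.elim, by simp [dotProduct, ArithExpr.eval]⟩
  | add φ₁ φ₂ ih₁ ih₂ =>
    obtain ⟨V₁, _, _, d₁, N₁, a₁, b₁, m₁, c₁, hc₁, hd₁, hN₁0, hN₁, ha₁, hb₁, hm₁, hdet₁, hw₁, y₁,
      hy₁, hv₁⟩ := ih₁
    obtain ⟨V₂, _, _, d₂, N₂, a₂, b₂, m₂, c₂, hc₂, hd₂, hN₂0, hN₂, ha₂, hb₂, hm₂, hdet₂, hw₂, y₂,
      hy₂, hv₂⟩ := ih₂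
    by_cases hc10 : c₁ = 0
    · -- `φ₁ = 0` (`c₁ = 0`): mirrored gadget with new vertex `w = t₁`, sink weight `0`, constant `c₂`
      have hφ₁ : φ₁.eval = 0 := by rw [← hv₁, hc10, C_0, zero_mul]
      refine ⟨V₁ ⊕ (Unit ⊕ V₂), inferInstance, inferInstance,
        Sum.elim d₁ (Sum.elim (fun _ => 1) d₂),
        Matrix.fromBlocks N₁ (Matrix.of fun v j => Sum.elim (fun _ => b₁ v) (fun _ => 0) j) 0
          (Matrix.fromBlocks 0 0 0 N₂),
        Sum.elim a₁ (Sum.elim (fun _ => m₁) a₂),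
        Sum.elim 0 (Sum.elim (fun _ => 0) b₂), m₂, c₂, ?_, ?_, ?_, ?_, ?_, ?_, ?_, ?_, ?_, ?_⟩
      · simp only [Fintype.card_sum, Fintype.card_unique, ArithExpr.greenSize_add]; omega
      · rintro (v | ⟨⟨⟩ | v⟩)
        · exact hd₁ v
        · exact Or.inl rfl
        · exact hd₂ v
      · rintro (v | ⟨⟨⟩ | v⟩)
        · exact hN₁0 v
        · rfl
        · exact hN₂0 v
      · rintro (u | ⟨⟨⟩ | u⟩) (v | ⟨⟨⟩ | v⟩)
        · exact (hN₁ u v).imp (fun h => Or.inl h) id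
        · exact (hb₁ u).imp (fun h => Or.inl h) id
        · exact Or.inr ⟨0, C_0.symm⟩
        · exact Or.inr ⟨0, C_0.symm⟩
        · exact Or.inr ⟨0, C_0.symm⟩
        · exact Or.inr ⟨0, C_0.symm⟩
        · exact Or.inr ⟨0, C_0.symm⟩
        · exact Or.inr ⟨0, C_0.symm⟩
        · exact (hN₂ u v).imp (fun h => Or.inr h) id
      · rintro (v | ⟨⟨⟩ | v⟩)
        · exact (ha₁ v).imp (fun h => Or.inl h) id
        · exact hm₁.imp (fun h => Or.inl h) id
        · exact (ha₂ v).imp (fun h => Or.inr h) id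
      · rintro (v | ⟨⟨⟩ | v⟩)
        · exact Or.inr ⟨0, C_0.symm⟩
        · exact Or.inr ⟨0, C_0.symm⟩
        · exact (hb₂ v).imp (fun h => Or.inr h) id
      · exact hm₂.imp (fun h => Or.inr h) id
      · have hD : diagonal (Sum.elim d₁ (Sum.elim (fun _ : Unit => (1 : MvPolynomial σ k)) d₂)) +
            Matrix.fromBlocks N₁ (Matrix.of fun v j => Sum.elim (fun _ => b₁ v) (fun _ => 0) j) 0
              (Matrix.fromBlocks 0 0 0 N₂) =
            Matrix.fromBlocks (diagonal d₁ + N₁)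
              (Matrix.of fun v j => Sum.elim (fun _ => b₁ v) (fun _ => 0) j) 0
              (Matrix.fromBlocks (diagonal fun _ : Unit => (1 : MvPolynomial σ k)) 0 0
                (diagonal d₂ + N₂)) := by
          rw [← fromBlocks_diagonal, ← fromBlocks_diagonal, fromBlocks_add, fromBlocks_add]
          simp
        rw [hD, det_fromBlocks_zero₂₁, det_fromBlocks_zero₂₁, det_diagonal]
        simp only [Finset.univ_unique, Finset.prod_singleton, one_mul]
        rcases hdet₁ with h1 | h1 <;> rcases hdet₂ with h2 | h2 <;> rw [h1, h2] <;> simp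
      · intro _
        refine ⟨Sum.inr (Sum.inl ()), ⟨0, C_0.symm⟩, ?_⟩
        rintro (u | ⟨⟨⟩ | u⟩) <;> exact ⟨0, C_0.symm⟩
      · refine ⟨Sum.elim 0 (Sum.elim (fun _ => 0) y₂), ?_, ?_⟩
        · have hD : diagonal (Sum.elim d₁ (Sum.elim (fun _ : Unit => (1 : MvPolynomial σ k)) d₂)) +
              Matrix.fromBlocks N₁ (Matrix.of fun v j => Sum.elim (fun _ => b₁ v) (fun _ => 0) j) 0
                (Matrix.fromBlocks 0 0 0 N₂) =
              Matrix.fromBlocks (diagonal d₁ + N₁)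
                (Matrix.of fun v j => Sum.elim (fun _ => b₁ v) (fun _ => 0) j) 0
                (Matrix.fromBlocks (diagonal fun _ : Unit => (1 : MvPolynomial σ k)) 0 0
                  (diagonal d₂ + N₂)) := by
            rw [← fromBlocks_diagonal, ← fromBlocks_diagonal, fromBlocks_add, fromBlocks_add]
            simp
          rw [hD, fromBlocks_mulVec, Sum.elim_comp_inl, Sum.elim_comp_inr, fromBlocks_mulVec,
            Sum.elim_comp_inl, Sum.elim_comp_inr, hy₂]
          simp only [Matrix.zero_mulVec, Matrix.mulVec_zero, add_zero, zero_add]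
          congr 1
          · funext v
            simp [mulVec, dotProduct, Fintype.sum_sum_type]
          · congr 1
            funext u
            simp [mulVec, dotProduct]
        · rw [sumElim_dotProduct_sumElim, sumElim_dotProduct_sumElim, ArithExpr.eval, hφ₁, ← hv₂,
            zero_add]
          simp [dotProduct]
    · -- GKKP's sum with constants: new vertex `w = t₂`, sink arc of weight `-c₂/c₁`, constant `c₁`
      refine ⟨V₁ ⊕ (Unit ⊕ V₂), inferInstance, inferInstance,
        Sum.elim d₁ (Sum.elim (fun _ => 1) d₂),
        Matrix.fromBlocks N₁ 0 0 (Matrix.fromBlocks 0 0 (Matrix.of fun v _ => b₂ v) N₂),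
        Sum.elim a₁ (Sum.elim (fun _ => m₂) a₂),
        Sum.elim b₁ (Sum.elim (fun _ => -C (c₂ / c₁)) 0), m₁, c₁, ?_, ?_, ?_, ?_, ?_, ?_, ?_, ?_,
        ?_, ?_⟩
      · simp only [Fintype.card_sum, Fintype.card_unique, ArithExpr.greenSize_add]; omega
      · rintro (v | ⟨⟨⟩ | v⟩)
        · exact hd₁ v
        · exact Or.inl rfl
        · exact hd₂ v
      · rintro (v | ⟨⟨⟩ | v⟩)
        · exact hN₁0 v
        · rfl
        · exact hN₂0 v
      · rintro (u | ⟨⟨⟩ | u⟩) (v | ⟨⟨⟩ | v⟩)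
        · exact (hN₁ u v).imp (fun h => Or.inl h) id
        · exact Or.inr ⟨0, C_0.symm⟩
        · exact Or.inr ⟨0, C_0.symm⟩
        · exact Or.inr ⟨0, C_0.symm⟩
        · exact Or.inr ⟨0, C_0.symm⟩
        · exact Or.inr ⟨0, C_0.symm⟩
        · exact Or.inr ⟨0, C_0.symm⟩
        · exact (hb₂ u).imp (fun h => Or.inr h) id
        · exact (hN₂ u v).imp (fun h => Or.inr h) id
      · rintro (v | ⟨⟨⟩ | v⟩)
        · exact (ha₁ v).imp (fun h => Or.inl h) id
        · exact hm₂.imp (fun h => Or.inr h) id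
        · exact (ha₂ v).imp (fun h => Or.inr h) id
      · rintro (v | ⟨⟨⟩ | v⟩)
        · exact (hb₁ v).imp (fun h => Or.inl h) id
        · exact Or.inr ⟨-(c₂ / c₁), show -C (c₂ / c₁) = C (-(c₂ / c₁)) by rw [C_neg]⟩
        · exact Or.inr ⟨0, C_0.symm⟩
      · exact hm₁.imp (fun h => Or.inl h) id
      · have hD : diagonal (Sum.elim d₁ (Sum.elim (fun _ : Unit => (1 : MvPolynomial σ k)) d₂)) +
            Matrix.fromBlocks N₁ 0 0 (Matrix.fromBlocks 0 0 (Matrix.of fun v _ => b₂ v) N₂) =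
            Matrix.fromBlocks (diagonal d₁ + N₁) 0 0
              (Matrix.fromBlocks (diagonal fun _ : Unit => (1 : MvPolynomial σ k)) 0
                (Matrix.of fun v _ => b₂ v) (diagonal d₂ + N₂)) := by
          rw [← fromBlocks_diagonal, ← fromBlocks_diagonal, fromBlocks_add, fromBlocks_add]
          simp
        rw [hD, det_fromBlocks_zero₂₁, det_fromBlocks_zero₁₂, det_diagonal]
        simp only [Finset.univ_unique, Finset.prod_singleton, one_mul]
        rcases hdet₁ with h1 | h1 <;> rcases hdet₂ with h2 | h2 <;> rw [h1, h2] <;> simp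
      · intro _
        refine ⟨Sum.inr (Sum.inl ()), ⟨-(c₂ / c₁), show -C (c₂ / c₁) = C (-(c₂ / c₁)) by rw [C_neg]⟩,
          ?_⟩
        rintro (u | ⟨⟨⟩ | u⟩) <;> exact ⟨0, C_0.symm⟩
      · refine ⟨Sum.elim y₁ (Sum.elim (fun _ => -C (c₂ / c₁))
          ((C (c₂ / c₁) : MvPolynomial σ k) • y₂)), ?_, ?_⟩
        · have hD : diagonal (Sum.elim d₁ (Sum.elim (fun _ : Unit => (1 : MvPolynomial σ k)) d₂)) +
              Matrix.fromBlocks N₁ 0 0 (Matrix.fromBlocks 0 0 (Matrix.of fun v _ => b₂ v) N₂) =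
              Matrix.fromBlocks (diagonal d₁ + N₁) 0 0
                (Matrix.fromBlocks (diagonal fun _ : Unit => (1 : MvPolynomial σ k)) 0
                  (Matrix.of fun v _ => b₂ v) (diagonal d₂ + N₂)) := by
            rw [← fromBlocks_diagonal, ← fromBlocks_diagonal, fromBlocks_add, fromBlocks_add]
            simp
          rw [hD, fromBlocks_mulVec, Sum.elim_comp_inl, Sum.elim_comp_inr, fromBlocks_mulVec,
            Sum.elim_comp_inl, Sum.elim_comp_inr]
          simp only [Matrix.mulVec_smul, hy₁, hy₂, Matrix.zero_mulVec, add_zero, zero_add,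
            smul_zero]
          congr 1
          congr 1
          · funext u
            simp [mulVec, dotProduct]
          · funext v
            simp [mulVec, dotProduct, Pi.smul_apply]
            ring
        · have hc₁C : (C c₁ : MvPolynomial σ k) * C (c₂ / c₁) = C c₂ := by
            rw [← C_mul, mul_div_cancel₀ _ hc10]
          have hu : ((fun _ : Unit => m₂) ⬝ᵥ fun _ => -C (c₂ / c₁)) = -(m₂ * C (c₂ / c₁)) := by
            simp [dotProduct]
          rw [sumElim_dotProduct_sumElim, sumElim_dotProduct_sumElim, dotProduct_smul,
            ArithExpr.eval, ← hv₁, ← hv₂, hu, smul_eq_mul]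
          linear_combination (m₂ - a₂ ⬝ᵥ y₂) * hc₁C
  | mul φ₁ φ₂ ih₁ ih₂ =>
    obtain ⟨V₁, _, _, d₁, N₁, a₁, b₁, m₁, c₁, hc₁, hd₁, hN₁0, hN₁, ha₁, hb₁, hm₁, hdet₁, hw₁, y₁,
      hy₁, hv₁⟩ := ih₁
    obtain ⟨V₂, _, _, d₂, N₂, a₂, b₂, m₂, c₂, hc₂, hd₂, hN₂0, hN₂, ha₂, hb₂, hm₂, hdet₂, hw₂, y₂,
      hy₂, hv₂⟩ := ih₂
    by_cases h₁ : φ₁.isConstInput = true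
    · -- `φ = c × φ₂`: free, constant `c c₂`
      obtain ⟨c, rfl⟩ := Thm3.exists_eq_const_of_isConstInput h₁
      refine ⟨V₂, inferInstance, inferInstance, d₂, N₂, a₂, b₂, m₂, c * c₂, ?_, hd₂, hN₂0,
        fun u v => (hN₂ u v).imp (fun h => Or.inr h) id, fun v => (ha₂ v).imp (fun h => Or.inr h) id,
        fun v => (hb₂ v).imp (fun h => Or.inr h) id, hm₂.imp (fun h => Or.inr h) id, hdet₂,
        (fun h => hw₂ (by
          rcases h with h | h
          · simp [ArithExpr.HasAddition] at h
          · exact h)),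
        y₂, hy₂, ?_⟩
      · rw [ArithExpr.greenSize_const_mul]; exact hc₂
      · rw [C_mul, mul_assoc, hv₂]; rfl
    by_cases h₂ : φ₂.isConstInput = true
    · -- `φ = φ₁ × c`: free, constant `c₁ c`
      obtain ⟨c, rfl⟩ := Thm3.exists_eq_const_of_isConstInput h₂
      refine ⟨V₁, inferInstance, inferInstance, d₁, N₁, a₁, b₁, m₁, c₁ * c, ?_, hd₁, hN₁0,
        fun u v => (hN₁ u v).imp (fun h => Or.inl h) id, fun v => (ha₁ v).imp (fun h => Or.inl h) id,
        fun v => (hb₁ v).imp (fun h => Or.inl h) id, hm₁.imp (fun h => Or.inl h) id, hdet₁,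
        (fun h => hw₁ (by
          rcases h with h | h
          · exact h
          · simp [ArithExpr.HasAddition] at h)),
        y₁, hy₁, ?_⟩
      · rw [ArithExpr.greenSize_mul_const]; exact hc₁
      · rw [C_mul, mul_comm (C c₁), mul_assoc, hv₁, mul_comm]; rfl
    -- non-constant factors: the product gadget of Thm. 2, constant `c₁ c₂`
    have h₁' : φ₁.isConstInput = false := by simpa using h₁
    have h₂' : φ₂.isConstInput = false := by simpa using h₂
    refine ⟨V₁ ⊕ (Unit ⊕ V₂), inferInstance, inferInstance,
      Sum.elim d₁ (Sum.elim (fun _ => -1) d₂),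
      Matrix.fromBlocks N₁ (Matrix.of fun v j => Sum.elim (fun _ => b₁ v) (fun _ => 0) j) 0
        (Matrix.fromBlocks 0 (Matrix.of fun _ u => a₂ u) 0 N₂),
      Sum.elim a₁ (Sum.elim (fun _ => m₁) 0),
      Sum.elim 0 (Sum.elim (fun _ => m₂) b₂), 0, c₁ * c₂, ?_, ?_, ?_, ?_, ?_, ?_, ?_, ?_, ?_, ?_⟩
    · rw [ArithExpr.greenSize_mul φ₁ φ₂ h₁' h₂']
      simp only [Fintype.card_sum, Fintype.card_unique]; omega
    · rintro (v | ⟨⟨⟩ | v⟩)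
      · exact hd₁ v
      · exact Or.inr rfl
      · exact hd₂ v
    · rintro (v | ⟨⟨⟩ | v⟩)
      · exact hN₁0 v
      · rfl
      · exact hN₂0 v
    · rintro (u | ⟨⟨⟩ | u⟩) (v | ⟨⟨⟩ | v⟩)
      · exact (hN₁ u v).imp (fun h => Or.inl h) id
      · exact (hb₁ u).imp (fun h => Or.inl h) id
      · exact Or.inr ⟨0, C_0.symm⟩
      · exact Or.inr ⟨0, C_0.symm⟩
      · exact Or.inr ⟨0, C_0.symm⟩
      · exact (ha₂ v).imp (fun h => Or.inr h) id
      · exact Or.inr ⟨0, C_0.symm⟩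
      · exact Or.inr ⟨0, C_0.symm⟩
      · exact (hN₂ u v).imp (fun h => Or.inr h) id
    · rintro (v | ⟨⟨⟩ | v⟩)
      · exact (ha₁ v).imp (fun h => Or.inl h) id
      · exact hm₁.imp (fun h => Or.inl h) id
      · exact Or.inr ⟨0, C_0.symm⟩
    · rintro (v | ⟨⟨⟩ | v⟩)
      · exact Or.inr ⟨0, C_0.symm⟩
      · exact hm₂.imp (fun h => Or.inr h) id
      · exact (hb₂ v).imp (fun h => Or.inr h) id
    · exact Or.inr ⟨0, C_0.symm⟩
    · have hD : diagonal (Sum.elim d₁ (Sum.elim (fun _ : Unit => (-1 : MvPolynomial σ k)) d₂)) +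
          Matrix.fromBlocks N₁ (Matrix.of fun v j => Sum.elim (fun _ => b₁ v) (fun _ => 0) j) 0
            (Matrix.fromBlocks 0 (Matrix.of fun _ u => a₂ u) 0 N₂) =
          Matrix.fromBlocks (diagonal d₁ + N₁)
            (Matrix.of fun v j => Sum.elim (fun _ => b₁ v) (fun _ => 0) j) 0
            (Matrix.fromBlocks (diagonal fun _ : Unit => (-1 : MvPolynomial σ k))
              (Matrix.of fun _ u => a₂ u) 0 (diagonal d₂ + N₂)) := by
        rw [← fromBlocks_diagonal, ← fromBlocks_diagonal, fromBlocks_add, fromBlocks_add]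
        simp
      rw [hD, det_fromBlocks_zero₂₁, det_fromBlocks_zero₂₁, det_diagonal]
      simp only [Finset.univ_unique, Finset.prod_singleton]
      rcases hdet₁ with h1 | h1 <;> rcases hdet₂ with h2 | h2 <;> rw [h1, h2] <;> simp
    · -- the constant-row witness of a summand survives the product construction
      rintro (h | h)
      · obtain ⟨w, ⟨c, hc⟩, hwN⟩ := hw₁ h
        refine ⟨Sum.inl w, ⟨0, C_0.symm⟩, ?_⟩
        rintro (u | ⟨⟨⟩ | u⟩)
        · exact hwN u
        · exact ⟨c, hc⟩
        · exact ⟨0, C_0.symm⟩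
      · obtain ⟨w, hwb, hwN⟩ := hw₂ h
        refine ⟨Sum.inr (Sum.inr w), hwb, ?_⟩
        rintro (u | ⟨⟨⟩ | u⟩)
        · exact ⟨0, C_0.symm⟩
        · exact ⟨0, C_0.symm⟩
        · exact hwN u
    · -- value: `y = ((m₂ − a₂·y₂) • y₁, −(m₂ − a₂·y₂), y₂)`
      refine ⟨Sum.elim ((m₂ - a₂ ⬝ᵥ y₂) • y₁) (Sum.elim (fun _ => -(m₂ - a₂ ⬝ᵥ y₂)) y₂), ?_, ?_⟩
      · have hD : diagonal (Sum.elim d₁ (Sum.elim (fun _ : Unit => (-1 : MvPolynomial σ k)) d₂)) +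
            Matrix.fromBlocks N₁ (Matrix.of fun v j => Sum.elim (fun _ => b₁ v) (fun _ => 0) j) 0
              (Matrix.fromBlocks 0 (Matrix.of fun _ u => a₂ u) 0 N₂) =
            Matrix.fromBlocks (diagonal d₁ + N₁)
              (Matrix.of fun v j => Sum.elim (fun _ => b₁ v) (fun _ => 0) j) 0
              (Matrix.fromBlocks (diagonal fun _ : Unit => (-1 : MvPolynomial σ k))
                (Matrix.of fun _ u => a₂ u) 0 (diagonal d₂ + N₂)) := by
          rw [← fromBlocks_diagonal, ← fromBlocks_diagonal, fromBlocks_add, fromBlocks_add]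
          simp
        rw [hD, fromBlocks_mulVec, Sum.elim_comp_inl, Sum.elim_comp_inr, fromBlocks_mulVec,
          Sum.elim_comp_inl, Sum.elim_comp_inr, Matrix.mulVec_smul, hy₁, hy₂]
        simp only [Matrix.zero_mulVec, zero_add]
        congr 1
        · funext v
          simp [mulVec, dotProduct, Fintype.sum_sum_type]
          ring
        · congr 1
          funext u
          simp [mulVec, dotProduct]
      · rw [sumElim_dotProduct_sumElim, sumElim_dotProduct_sumElim, dotProduct_smul,
          ArithExpr.eval, ← hv₁, ← hv₂, C_mul]
        simp [dotProduct]
        ring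


end Thm1

end GKKP2011

/-! ### The named fact -/

open GKKP2011 in
/-- **GKKP 2011, Theorem 1 ([LR06]) — PROVED**: over a field of characteristic `≠ 2`, a formula of
green size `e` with at least one addition gate is the determinant of a (not necessarily symmetric)
matrix of size `e + 1` with entries inputs of `φ` or constants of `k`. Discharges `GKKP2011_thm1`.
[cite: GrenetEtAl2011, Thm 1] -/
theorem GKKP2011_thm1_holds : GKKP2011_thm1 := by
  intro k _ h2 σ φ hadd
  classical
  obtain ⟨V, _, _, d, N, a, b, m, c₀, hc, hd, hN0, hN, ha, hb, hm, hdet, hw, y, hy, hv⟩ :=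
    Thm1.exists_signedABP φ
  obtain ⟨w, ⟨cb, hcb⟩, hwN⟩ := hw hadd
  -- pad with `r` isolated internal vertices up to `|V| + r = gsize(φ)`
  obtain ⟨r, hr⟩ : ∃ r, Fintype.card V + r = φ.greenSize := ⟨φ.greenSize - Fintype.card V, by omega⟩
  set W : Type := V ⊕ Fin r
  set d' : W → MvPolynomial σ k := Sum.elim d (fun _ => 1) with hd'
  set N' : Matrix W W (MvPolynomial σ k) := Matrix.fromBlocks N 0 0 0 with hN'
  set a' : W → MvPolynomial σ k := Sum.elim a 0 with ha'
  set b' : W → MvPolynomial σ k := Sum.elim b 0 with hb'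
  set T : Matrix W W (MvPolynomial σ k) := diagonal d' + N' with hT
  have hTblk : T = Matrix.fromBlocks (diagonal d + N) 0 0
      (diagonal fun _ : Fin r => (1 : MvPolynomial σ k)) := by
    rw [hT, hd', hN', ← fromBlocks_diagonal, fromBlocks_add]
    simp
  have hdetT : T.det = 1 ∨ T.det = -1 := by
    rw [hTblk, det_fromBlocks_zero₂₁, det_diagonal]
    simp only [Finset.prod_const_one, mul_one]
    exact hdet
  have hdetsq : T.det * T.det = 1 := by
    rcases hdetT with h | h <;> rw [h] <;> norm_num
  have hunit : IsUnit T.det := by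
    rcases hdetT with h | h <;> rw [h]
    · exact isUnit_one
    · exact isUnit_one.neg
  have hG : T * T⁻¹ = 1 := Matrix.mul_nonsing_inv T hunit
  have hG' : T⁻¹ * T = 1 := Matrix.nonsing_inv_mul T hunit
  have hy' : T *ᵥ Sum.elim y 0 = b' := by
    rw [hTblk, fromBlocks_mulVec, Sum.elim_comp_inl, Sum.elim_comp_inr, hy, hb']
    simp
  have hyG : T⁻¹ *ᵥ b' = Sum.elim y 0 := by
    rw [← hy', Matrix.mulVec_mulVec, hG', Matrix.one_mulVec]
  have hval : a' ⬝ᵥ Sum.elim y 0 = a ⬝ᵥ y := by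
    rw [ha', sumElim_dotProduct_sumElim, zero_dotProduct, add_zero]
  -- the digraph matrix `M = [[m, a], [b, T]]` and its determinant `det T · (m − a·y)`
  set M : Matrix (Fin 1 ⊕ W) (Fin 1 ⊕ W) (MvPolynomial σ k) :=
    Matrix.fromBlocks !![m] (Matrix.of fun _ v => a' v) (Matrix.of fun v _ => b' v) T with hM
  have hdetM : M.det = T.det * (m - a ⬝ᵥ y) := by
    letI : Invertible T := invertibleOfRightInverse _ _ hG
    have hinv : ⅟T = T⁻¹ := invOf_eq_right_inv hG
    rw [hM, det_fromBlocks₂₂, hinv, det_fin_one, Matrix.sub_apply]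
    congr 1
    have hq : ((Matrix.of fun (_ : Fin 1) v => a' v) * T⁻¹ * Matrix.of fun v (_ : Fin 1) => b' v) 0 0
        = a' ⬝ᵥ (T⁻¹ *ᵥ b') := by
      simp only [Matrix.mul_apply, Matrix.of_apply, dotProduct, mulVec, Finset.sum_mul]
      rw [Finset.sum_comm]
      refine Finset.sum_congr rfl fun u _ => ?_
      rw [Finset.mul_sum]
      refine Finset.sum_congr rfl fun v _ => ?_
      ring
    rw [hq, hyG, hval]
    simp
  -- the scaling constant `κ = c₀ · det T`
  obtain ⟨κ, hκ⟩ : ∃ κ : k, (C κ : MvPolynomial σ k) = C c₀ * T.det := by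
    rcases hdetT with h | h
    · exact ⟨c₀, by rw [h, mul_one]⟩
    · exact ⟨-c₀, by rw [h, C_neg, mul_neg_one]⟩
  set M' := M.updateRow (Sum.inr (Sum.inl w)) ((C κ : MvPolynomial σ k) • M (Sum.inr (Sum.inl w)))
    with hM'
  have hdetM' : M'.det = φ.eval := by
    rw [hM', det_updateRow_smul, updateRow_eq_self, hdetM, hκ, ← hv]
    calc C c₀ * T.det * (T.det * (m - a ⬝ᵥ y)) = C c₀ * (T.det * T.det) * (m - a ⬝ᵥ y) := by ring
      _ = C c₀ * (m - a ⬝ᵥ y) := by rw [hdetsq, mul_one]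
  -- entries of the padded data
  have h0c : ∃ c : k, (0 : MvPolynomial σ k) = C c := ⟨0, C_0.symm⟩
  have hd'' : ∀ x, ∃ c : k, d' x = C c := by
    rintro (v | j)
    · rcases hd v with h | h
      · exact ⟨1, by rw [show d' (Sum.inl v) = d v from rfl, h, C_1]⟩
      · exact ⟨-1, by rw [show d' (Sum.inl v) = d v from rfl, h, C_neg, C_1]⟩
    · exact ⟨1, C_1.symm⟩
  have hN'0 : ∀ x, N' x x = 0 := by
    rintro (v | j)
    · exact hN0 v
    · rfl
  have hN'' : ∀ u x, φ.IsInput (N' u x) ∨ ∃ c : k, N' u x = C c := by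
    rintro (u | u) (x | x)
    · exact hN u x
    · exact Or.inr h0c
    · exact Or.inr h0c
    · exact Or.inr h0c
  have ha'' : ∀ x, φ.IsInput (a' x) ∨ ∃ c : k, a' x = C c := by
    rintro (v | j)
    · exact ha v
    · exact Or.inr h0c
  have hb'' : ∀ x, φ.IsInput (b' x) ∨ ∃ c : k, b' x = C c := by
    rintro (v | j)
    · exact hb v
    · exact Or.inr h0c
  have hT'' : ∀ u x, φ.IsInput (T u x) ∨ ∃ c : k, T u x = C c := by
    intro u x
    rw [hT, Matrix.add_apply, diagonal_apply]
    by_cases hux : u = x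
    · subst hux
      rw [if_pos rfl, hN'0, add_zero]
      exact Or.inr (hd'' u)
    · rw [if_neg hux, zero_add]
      exact hN'' u x
  -- the entries of `M`, and of the scaled row
  have hMent : ∀ i j, φ.IsInput (M i j) ∨ ∃ c : k, M i j = C c := by
    rintro (i | i) (j | j)
    · rw [hM, Matrix.fromBlocks_apply₁₁]
      fin_cases i; fin_cases j
      exact hm
    · rw [hM, Matrix.fromBlocks_apply₁₂, Matrix.of_apply]
      exact ha'' j
    · rw [hM, Matrix.fromBlocks_apply₂₁, Matrix.of_apply]
      exact hb'' i
    · rw [hM, Matrix.fromBlocks_apply₂₂]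
      exact hT'' i j
  have hrow : ∀ j, ∃ c : k, M (Sum.inr (Sum.inl w)) j = C c := by
    rintro (j | j)
    · rw [hM, Matrix.fromBlocks_apply₂₁, Matrix.of_apply]
      exact ⟨cb, hcb⟩
    · rw [hM, Matrix.fromBlocks_apply₂₂, hT, Matrix.add_apply, diagonal_apply]
      by_cases hwj : (Sum.inl w : W) = j
      · subst hwj
        rw [if_pos rfl, hN'0, add_zero]
        exact hd'' _
      · rw [if_neg hwj, zero_add]
        rcases j with u | u
        · exact hwN u
        · exact ⟨0, by rw [hN', Matrix.fromBlocks_apply₁₂, C_0]; rfl⟩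
  -- reindex to `Fin (gsize + 1)`
  have hcard : Fintype.card (Fin 1 ⊕ W) = φ.greenSize + 1 := by
    simp only [Fintype.card_sum, Fintype.card_fin, W, ← hr]
    ring
  let e := Fintype.equivFinOfCardEq hcard
  refine ⟨Matrix.reindex e e M', ?_, ?_⟩
  · intro i j
    rw [Matrix.reindex_apply, Matrix.submatrix_apply, hM']
    by_cases hi : e.symm i = Sum.inr (Sum.inl w)
    · rw [hi, updateRow_self, Pi.smul_apply, smul_eq_mul]
      obtain ⟨c, hc'⟩ := hrow (e.symm j)
      exact Or.inr ⟨κ * c, by rw [hc', ← C_mul]⟩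
    · rw [updateRow_ne hi]
      exact hMent _ _
  · rw [Matrix.det_reindex_self, hdetM']

/-! ### Tree-vocabulary corollaries (unconditional forms of `GKKP2011_thm1.hasDetRepr`) -/

/-- **Thm. 1 in tree vocabulary, PROVED**: over a field of characteristic `≠ 2`, the value of a
formula of green size `e` with an addition gate has an affine determinantal representation of size
`e + 1` (= `GKKP2011_thm1.hasDetRepr` applied to `GKKP2011_thm1_holds`). [cite: GrenetEtAl2011, Thm 1] -/
theorem ArithExpr.hasDetRepr_eval_greenSize_succ (k : Type) [Field k] (h2 : (2 : k) ≠ 0) (σ : Type)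
    (φ : ArithExpr k σ) (hφ : φ.HasAddition) : HasDetRepr φ.eval (φ.greenSize + 1) :=
  GKKP2011_thm1.hasDetRepr GKKP2011_thm1_holds k h2 σ φ hφ

/-- **`dc` of a formula (Liu–Regan / GKKP Thm. 1)**: over a field of characteristic `≠ 2`,
`dc(φ) ≤ gsize(φ) + 1` for every formula `φ` with an addition gate.
[cite: GrenetEtAl2011, Thm 1] -/
theorem ArithExpr.determinantalComplexity_eval_le_greenSize_succ (k : Type) [Field k]
    (h2 : (2 : k) ≠ 0) (σ : Type) (φ : ArithExpr k σ) (hφ : φ.HasAddition) :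
    determinantalComplexity φ.eval ≤ φ.greenSize + 1 :=
  determinantalComplexity_le_of_hasDetRepr (ArithExpr.hasDetRepr_eval_greenSize_succ k h2 σ φ hφ)

/-! ### `dc(φ) ≤ gsize(φ) + 1` for EVERY formula (the addition-free case is a diagonal matrix) -/

/-- Scaling one row of an affine determinantal representation by a constant gives an affine
determinantal representation of the scaled polynomial. [folklore] -/
private theorem hasDetRepr_C_mul {k : Type} [Field k] {σ : Type} {f : MvPolynomial σ k} {n : ℕ}
    (h : HasDetRepr f (n + 1)) (c : k) : HasDetRepr (C c * f) (n + 1) := by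
  obtain ⟨A, hdeg, hdet⟩ := h
  refine ⟨A.updateRow 0 ((C c : MvPolynomial σ k) • A 0), fun i j => ?_, ?_⟩
  · by_cases hi : i = 0
    · subst hi
      rw [updateRow_self, Pi.smul_apply, smul_eq_mul]
      exact (totalDegree_mul _ _).trans (by rw [totalDegree_C, zero_add]; exact hdeg 0 j)
    · rw [updateRow_ne hi]
      exact hdeg i j
  · rw [det_updateRow_smul, updateRow_eq_self, hdet]

/-- **Addition-free formulas** (GKKP, remark after Thm. 1, p0007: "if `φ` has no addition it is of
the form `c x₁ ⋯ x_n` … a suitable matrix is the … diagonal matrix made of the `n` variables and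
the constant `c`"): a formula without addition gates has an affine determinantal representation of
size `gsize(φ) + 1` — block-diagonal along the multiplication tree, the constant inputs being
absorbed into a row of the neighbouring block (so no extra row for `c`).
[cite: GrenetEtAl2011, Thm 1 (remark)] -/
theorem ArithExpr.hasDetRepr_eval_of_not_hasAddition {k : Type} [Field k] {σ : Type} :
    ∀ φ : ArithExpr k σ, ¬ φ.HasAddition → HasDetRepr φ.eval (φ.greenSize + 1)
  | ArithExpr.var i, _ => ⟨!![X i], fun a b => by
      fin_cases a; fin_cases b; exact (totalDegree_X (R := k) i).le, by simp⟩
  | ArithExpr.const c, _ => ⟨!![C c], fun a b => by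
      fin_cases a; fin_cases b
      show (C c : MvPolynomial σ k).totalDegree ≤ 1
      rw [totalDegree_C]; exact Nat.zero_le _, by simp⟩
  | ArithExpr.add _ _, h => absurd trivial h
  | ArithExpr.mul φ₁ φ₂, h => by
    have h₁ : ¬ φ₁.HasAddition := fun h' => h (Or.inl h')
    have h₂ : ¬ φ₂.HasAddition := fun h' => h (Or.inr h')
    have ih₁ := ArithExpr.hasDetRepr_eval_of_not_hasAddition φ₁ h₁
    have ih₂ := ArithExpr.hasDetRepr_eval_of_not_hasAddition φ₂ h₂
    by_cases hc₁ : φ₁.isConstInput = true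
    · obtain ⟨c, rfl⟩ := GKKP2011.Thm3.exists_eq_const_of_isConstInput hc₁
      rw [ArithExpr.greenSize_const_mul, ArithExpr.eval_mul, ArithExpr.eval_const]
      exact hasDetRepr_C_mul ih₂ c
    by_cases hc₂ : φ₂.isConstInput = true
    · obtain ⟨c, rfl⟩ := GKKP2011.Thm3.exists_eq_const_of_isConstInput hc₂
      rw [ArithExpr.greenSize_mul_const, ArithExpr.eval_mul, ArithExpr.eval_const, mul_comm]
      exact hasDetRepr_C_mul ih₁ c
    have hc₁' : φ₁.isConstInput = false := by simpa using hc₁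
    have hc₂' : φ₂.isConstInput = false := by simpa using hc₂
    rw [ArithExpr.greenSize_mul φ₁ φ₂ hc₁' hc₂', ArithExpr.eval_mul]
    obtain ⟨A₁, hdeg₁, hdet₁⟩ := ih₁
    obtain ⟨A₂, hdeg₂, hdet₂⟩ := ih₂
    have hsize : (φ₁.greenSize + 1) + (φ₂.greenSize + 1) = φ₁.greenSize + φ₂.greenSize + 1 + 1 := by
      ring
    let e : Fin (φ₁.greenSize + 1) ⊕ Fin (φ₂.greenSize + 1) ≃
        Fin (φ₁.greenSize + φ₂.greenSize + 1 + 1) := finSumFinEquiv.trans (finCongr hsize)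
    refine ⟨Matrix.reindex e e (Matrix.fromBlocks A₁ 0 0 A₂), fun i j => ?_, ?_⟩
    · rw [Matrix.reindex_apply, Matrix.submatrix_apply]
      rcases e.symm i with i' | i' <;> rcases e.symm j with j' | j'
      · exact hdeg₁ i' j'
      · simp
      · simp
      · exact hdeg₂ i' j'
    · rw [Matrix.det_reindex_self, Matrix.det_fromBlocks_zero₂₁, hdet₁, hdet₂]

/-- **`dc(φ) ≤ gsize(φ) + 1` for every formula** over a field of characteristic `≠ 2`: with an
addition gate this is GKKP Thm. 1 (`GKKP2011_thm1_holds`), without one the diagonal representation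
(`ArithExpr.hasDetRepr_eval_of_not_hasAddition`). [cite: GrenetEtAl2011, Thm 1] -/
theorem ArithExpr.determinantalComplexity_eval_le (k : Type) [Field k] (h2 : (2 : k) ≠ 0)
    (σ : Type) (φ : ArithExpr k σ) : determinantalComplexity φ.eval ≤ φ.greenSize + 1 := by
  by_cases hφ : φ.HasAddition
  · exact ArithExpr.determinantalComplexity_eval_le_greenSize_succ k h2 σ φ hφ
  · exact determinantalComplexity_le_of_hasDetRepr
      (ArithExpr.hasDetRepr_eval_of_not_hasAddition φ hφ)

end Literature.Computability.AlgebraicComplexity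

end
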